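import Summits.CriticalPhenomena.CardyFormulaZ2.Theorems.CardyBoundaryCoulombGasHalfPlaneMarkDensityLawTwoArmPointLower

/-!
# Lead's skeleton (c12-0): the remaining structural gap — density POSITIVITY from two-arm EXTENDABILITY

Not attempted this seat (see crux NOTES): `stub_twoArmExtendability` is Kesten's extension of the boundary
two-arm event from radius `θn` to the macroscopic first-hit configuration (needs outer arm separation on
bond-`ℤ²` in the half-plane); with the landed `TwoArmLower.stub_lisoLowerBound` it gives `stub_densityPositivity`.
-/

noncomputable section

namespace Summit.CriticalPhenomena.CardyFormulaZ2.Cruxes.HalfPlaneMarkDensityLaw.SketchLine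

open Literature.Probability.Percolation Literature.Probability.LatticeModels
open MeasureTheory Filter Set SimpleGraph
open scoped Topology
open Summit.CriticalPhenomena.CardyFormulaZ2.Theorems.HalfPlaneMarkDensityLaw.Negative

namespace TwoArmLower

/-- STUB (not attempted): outer extendability of the boundary two-arm event into the crux's first-hit event. [folklore] -/
theorem stub_twoArmExtendability :
    ∀ (a b c x : ℝ), a < b → b < c → c < x → ∃ cE θ : ℝ, 0 < cE ∧ 0 < θ ∧ ∀ᶠ n : ℕ in atTop,
      cE * μ.real (TwoArm.liso ⌊x * n⌋ ⌊θ * n⌋₊) ≤ μ.real (markEvent a b c x n) := by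
  sorry

/-- STUB (target): POSITIVITY of the crux's density sequence, `liminf n·P[E_n(a,b,c,x)] > 0`. [folklore] -/
theorem stub_densityPositivity :
    ∀ (a b c x : ℝ), a < b → b < c → c < x → ∃ c₁ : ℝ, 0 < c₁ ∧ ∀ᶠ n : ℕ in atTop, c₁ ≤ lawSeq a b c x n := by
  intro a b c x hab hbc hcx
  obtain ⟨cE, θ, hcE, hθ, hev⟩ := stub_twoArmExtendability a b c x hab hbc hcx
  obtain ⟨c₀, hc₀, R₀, hlow⟩ := stub_lisoLowerBound
  refine ⟨cE * c₀ / (2 * θ), by positivity, ?_⟩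
  have eR : ∀ᶠ n : ℕ in atTop, (R₀ : ℝ) + 1 ≤ θ * n :=
    (tendsto_natCast_atTop_atTop.const_mul_atTop hθ).eventually_ge_atTop _
  filter_upwards [hev, eR, eventually_ge_atTop 1] with n hn hRn hn1
  have hn0 : (0 : ℝ) < n := by exact_mod_cast hn1
  have hθn : (R₀ : ℝ) ≤ (⌊θ * (n : ℝ)⌋₊ : ℝ) := by
    have := Nat.lt_floor_add_one (θ * n); linarith
  have hR : R₀ ≤ ⌊θ * (n : ℝ)⌋₊ := by exact_mod_cast hθn
  have hliso : c₀ / (⌊θ * (n : ℝ)⌋₊ : ℝ) ≤ μ.real (TwoArm.liso ⌊x * n⌋ ⌊θ * n⌋₊) := (hlow ⌊x * n⌋ _ hR).1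
  have hfl : (⌊θ * (n : ℝ)⌋₊ : ℝ) ≤ θ * n := Nat.floor_le (by positivity)
  have hflpos : (0 : ℝ) < (⌊θ * (n : ℝ)⌋₊ : ℝ) := by
    have h := Nat.lt_floor_add_one (θ * (n : ℝ))
    have h0 : (0 : ℝ) ≤ R₀ := Nat.cast_nonneg _
    linarith
  have h1 : c₀ / (θ * n) ≤ c₀ / (⌊θ * (n : ℝ)⌋₊ : ℝ) := div_le_div_of_nonneg_left hc₀.le hflpos hfl
  have h2 : cE * (c₀ / (θ * n)) ≤ μ.real (markEvent a b c x n) := by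
    calc cE * (c₀ / (θ * n)) ≤ cE * μ.real (TwoArm.liso ⌊x * n⌋ ⌊θ * n⌋₊) := by gcongr; exact h1.trans hliso
      _ ≤ _ := hn
  show cE * c₀ / (2 * θ) ≤ (n : ℝ) * μ.real (markEvent a b c x n)
  have h3 : (n : ℝ) * (cE * (c₀ / (θ * n))) = cE * c₀ / θ := by field_simp
  have h4 : cE * c₀ / (2 * θ) ≤ cE * c₀ / θ := by
    rw [div_le_div_iff₀ (by positivity) hθ]; nlinarith [mul_pos hcE hc₀]
  calc cE * c₀ / (2 * θ) ≤ cE * c₀ / θ := h4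
    _ = (n : ℝ) * (cE * (c₀ / (θ * n))) := h3.symm
    _ ≤ (n : ℝ) * μ.real (markEvent a b c x n) := by gcongr

end TwoArmLower

end Summit.CriticalPhenomena.CardyFormulaZ2.Cruxes.HalfPlaneMarkDensityLaw.SketchLine
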